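import Literature.AlgebraicGeometry.Resolution.CobordantBlowupAlgebra
import Literature.AlgebraicGeometry.Resolution.AffineBlowupUnique
import Literature.AlgebraicGeometry.Resolution.MarkedIdeals
import HarnessLib

/-!
# Cobordant blow-ups (Włodarczyk 2022), II: the schemes `B`, `B₊`, the exceptional divisor,
# strict transforms

Topic: `Literature/AlgebraicGeometry/Resolution`. Definition request `defn-CobordantBlowup`
(route `ResolutionOfSingularities/WeightedInvariant`). Continuation of
`CobordantBlowupAlgebra.lean`, where the algebra `𝒪_B = A[t⁻¹, u₁ t^{w₁}, …, u_k t^{w_k}]`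
(`cobordantAlgebra u w ⊆ A[t, t⁻¹]`) of the full cobordant blow-up of the weighted centre
`𝒥 = (u₁^{1/w₁}, …, u_k^{1/w_k})` on `Spec A` is defined (J. Włodarczyk, *Functorial resolution
by torus actions*, arXiv:2203.03090, Def. 2.3.5). Here, over Mathlib's `AlgebraicGeometry.Scheme`
and the blow-up vocabulary of this topic (`Blowups.lean`, `AffineBlowupCartier.lean`,
`MarkedIdeals.lean`):

* `cobordantBlowup u w := Spec 𝒪_B` — **the full cobordant blow-up `B`** of Def. 2.3.5 (affine
  model `X = Spec A`), with its projection `cobordantBlowup.π : B ⟶ Spec A` (`σ` in the source)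
  — the `𝔾_m`-action is the grading `cobordantAlgebra.weightSpace` of part I;
* `cobordantBlowup.chart i = D(uᵢ')` and `cobordantBlowup.plus = ⋃ᵢ D(uᵢ') = B ∖ Vert(B)` —
  **`B₊`**, the complement of the vertex `Vert(B) = V(u₁', …, u_k')` (`mem_plus_iff_not_le`,
  `coe_support_vertex`: the support of the vertex ideal sheaf is exactly the complement of
  `B₊`); `cobordantBlowup.πPlus : B₊ ⟶ Spec A` — **the cobordant blow-up `σ₊`** (Def. 2.3.5);
* `cobordantBlowup.exc = (s)~` — the ideal sheaf of `V(t⁻¹)`, and `cobordantBlowup.excPlus`, its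
  restriction to `B₊` = **the exceptional divisor `D`** (Lemma 2.3.8);
* `cobordantBlowup.awayι : Spec A[t, t⁻¹] ⟶ B` — **the trivial cobordant blow-up
  `B₋ = B ∖ V(t⁻¹) = Spec A × 𝔾_m`**: an open immersion with image `D(s)`
  (`isOpenImmersion_awayι`, `opensRange_awayι`; Def. 2.3.5);
* `cobordantBlowup.chartι i : Spec 𝒪_B[1/uᵢ'] ⟶ B`, the open immersion onto the chart `D(uᵢ')`
  of `B₊`, and **Lemma 2.3.8 on the charts**: the inverse image of the centre
  `(u₁^{a₁}, …, u_k^{a_k})` (`aᵢ wᵢ = m`) along `Spec 𝒪_B[1/uᵢ'] → B → Spec A` is the ideal sheaf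
  of `s^m` (`comap_centrePow_chart`), for weights `1` the exceptional ideal sheaf itself
  (`comap_centre_chart`: `𝒥 · 𝒪_{B₊} = t⁻¹ · 𝒪_{B₊}`);
* `cobordantBlowup.strictTransform K = ⋃ₙ (π^* K : 𝓘(D)ⁿ)` — **the strict transform** of an
  ideal sheaf `K` of `Spec A` on `B` (§3.3: the `t⁻¹`-saturation of the total transform), in the
  rendering of `strictTransformIdeal` (`MarkedIdeals.lean`) with the exceptional ideal `(s)` in
  place of the pulled-back centre, and `strictTransformPlus K`, its restriction to `B₊` — the
  transform `(Y', X') := (B₊, strict transform of X)` used by the route's `WeightedResolutionDatum`.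

## Not here

The global (non-affine) `B = Spec_Y 𝒪_Y[t⁻¹, 𝒥ₙ tⁿ]`; regularity of `B` (§2.3.9); Lemma 4.6.1
(`B₊ → Bl_𝒥` a `𝔾_m`-bundle for weights `1`); the stack quotient `[B₊/𝔾_m]` (not a scheme, not
requested). See the module docstring of part I.

## Sources

* J. Włodarczyk, arXiv:2203.03090 (July 2025 version): Def. 2.3.5, Lemma 2.3.8, §2.3.9,
  Rem. 2.3.10 (PDF pp. 10–11); §3.3 "Strict transform of ideals". [Wlodarczyk2022]
-/

noncomputable section

open scoped LaurentPolynomial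
open LaurentPolynomial CategoryTheory AlgebraicGeometry TopologicalSpace

namespace Literature.AlgebraicGeometry.Resolution

universe u v

variable {A : Type u} [CommRing A] {ι : Type v} (u : ι → A) (w : ι → ℕ)

/-- **The full cobordant blow-up `B = Spec A[t⁻¹, u₁ t^{w₁}, …, u_k t^{w_k}]`** of the weighted
centre `𝒥 = (u₁^{1/w₁}, …, u_k^{1/w_k})` on the affine scheme `Spec A` (Włodarczyk, Def. 2.3.5:
`B := Spec_X (𝒪_X[t⁻¹, t^{w₁} x₁, …, t^{w_k} x_k])`), a scheme affine over `Spec A`; the torus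
`𝔾_m` acts through the `t`-grading (`cobordantAlgebra.weightSpace`). In the source `X` is
regular and the `uᵢ` are part of a regular system of parameters with positive weights; the
construction needs neither. [cite: Wlodarczyk2022, Def. 2.3.5] -/
abbrev cobordantBlowup : Scheme.{u} :=
  Spec (.of (cobordantAlgebra u w))

namespace cobordantBlowup

/-- The projection `σ : B ⟶ Spec A` of the full cobordant blow-up (`Spec` of `A → 𝒪_B`).
[cite: Wlodarczyk2022, Def. 2.3.5] -/
def π : cobordantBlowup u w ⟶ Spec (.of A) :=
  Spec.map (CommRingCat.ofHom (algebraMap A (cobordantAlgebra u w)))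

/-! ## `B₊ = B ∖ Vert(B)` -/

/-- The chart `D(uᵢ') = B ∖ V(uᵢ t^{wᵢ})` of `B`; these cover `B₊` (Włodarczyk, proof of
Lemma 4.6.1: "the open cover of `B₊` consists of charts `B_{uᵢ t}`"). [cite: Wlodarczyk2022, Lemma 4.6.1] -/
def chart (i : ι) : (cobordantBlowup u w).Opens :=
  PrimeSpectrum.basicOpen (cobordantAlgebra.u' u w i)

/-- **`B₊ := B ∖ V(t^{w₁} u₁, …, t^{w_k} u_k)`**, the complement of the vertex, as an open
subset of `B` (Włodarczyk, Def. 2.3.5): the union of the charts `D(uᵢ')`.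
[cite: Wlodarczyk2022, Def. 2.3.5] -/
def plus : (cobordantBlowup u w).Opens :=
  ⨆ i, chart u w i

/-- `p ∈ D(uᵢ') ↔ uᵢ' ∉ p`. [folklore] -/
theorem mem_chart_iff (i : ι) (p : cobordantBlowup u w) :
    p ∈ chart u w i ↔ cobordantAlgebra.u' u w i ∉ p.asIdeal :=
  PrimeSpectrum.mem_basicOpen _ p

/-- `p ∈ B₊ ↔ some uᵢ' ∉ p`. [folklore] -/
theorem mem_plus_iff (p : cobordantBlowup u w) :
    p ∈ plus u w ↔ ∃ i, cobordantAlgebra.u' u w i ∉ p.asIdeal := by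
  simp only [plus, Opens.mem_iSup, mem_chart_iff]

/-- **`B₊` is the complement of the vertex** `V(u₁', …, u_k')`: `p ∈ B₊ ↔ (u₁', …, u_k') ⊄ p`.
[cite: Wlodarczyk2022, Def. 2.3.5] -/
theorem mem_plus_iff_not_le (p : cobordantBlowup u w) :
    p ∈ plus u w ↔ ¬ cobordantAlgebra.vertexIdeal u w ≤ p.asIdeal := by
  rw [mem_plus_iff, cobordantAlgebra.vertexIdeal, Ideal.span_le, Set.range_subset_iff, not_forall]
  rfl

/-- **The vertex `Vert(B) = V(t^{w₁} u₁, …, t^{w_k} u_k)`** as a closed subscheme of `B`: the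
ideal sheaf of `(u₁', …, u_k')` (Włodarczyk, Def. 2.3.5: "the geometric counterpart of the center
`𝒥` on `X` inside `B`"). [cite: Wlodarczyk2022, Def. 2.3.5] -/
def vertex : (cobordantBlowup u w).IdealSheafData :=
  affineBlowup.idealSheaf (cobordantAlgebra.vertexIdeal u w)

/-- `Vert(B) = B ∖ B₊` (Włodarczyk, Def. 2.3.5): the support of the vertex ideal sheaf is the
complement of `B₊`. [cite: Wlodarczyk2022, Def. 2.3.5] -/
theorem coe_support_vertex :
    ((vertex u w).support : Set (cobordantBlowup u w)) = (plus u w : Set (cobordantBlowup u w))ᶜ := by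
  rw [vertex, affineBlowup.support_idealSheaf]
  ext p
  exact ⟨fun h hp => (mem_plus_iff_not_le u w p).mp hp h,
    fun h => not_not.mp fun hn => h ((mem_plus_iff_not_le u w p).mpr hn)⟩

/-- **The cobordant blow-up `σ₊ : B₊ ⟶ Spec A`** of the weighted centre `𝒥` (Włodarczyk,
Def. 2.3.5: "the `T`-equivariant morphism `σ₊ : B₊ := B ∖ V(t^{w₁} x₁, …, t^{w_k} x_k) → X`,
where `B₊` is the complement of the vertex and corresponds to the weighted blow-up determined
by `𝒥`"), `B₊` being the open subscheme `plus u w` of `B`. [cite: Wlodarczyk2022, Def. 2.3.5] -/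
def πPlus : (plus u w : Scheme.{u}) ⟶ Spec (.of A) :=
  (plus u w).ι ≫ π u w

/-! ## The exceptional divisor and the trivial cobordant blow-up -/

/-- The ideal sheaf `(s) = (t⁻¹)` on `B`, whose zero locus is `Vert(B) ∪ D`... more precisely
whose restriction to `B₊` is the exceptional divisor `D = V(t⁻¹)` (Włodarczyk, Lemma 2.3.8).
[cite: Wlodarczyk2022, Lemma 2.3.8] -/
def exc : (cobordantBlowup u w).IdealSheafData :=
  affineBlowup.idealSheaf (cobordantAlgebra.excIdeal u w)

/-- **The exceptional divisor `D = V(t⁻¹) ∩ B₊`** of the cobordant blow-up `σ₊ : B₊ → Spec A`,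
as an ideal sheaf on `B₊` (Włodarczyk, Lemma 2.3.8). [cite: Wlodarczyk2022, Lemma 2.3.8] -/
def excPlus : (plus u w : Scheme.{u}).IdealSheafData :=
  (exc u w).comap (plus u w).ι

/-- The ideal sheaf of the centre `V(u₁, …, u_k)` on `Spec A` (support of `𝒥`). [folklore] -/
def centre : (Spec (.of A)).IdealSheafData :=
  affineBlowup.idealSheaf (Ideal.span (Set.range u))

/-- `A[t, t⁻¹]` is the localization of `𝒪_B` at `s = t⁻¹` (`cobordantAlgebra.isLocalization_away_s`
of part I, registered as an instance for the algebra structure `𝒪_B ⊆ A[t, t⁻¹]`).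
[cite: Wlodarczyk2022, Def. 2.3.5] -/
instance _root_.Literature.AlgebraicGeometry.Resolution.cobordantAlgebra.instIsLocalizationAwayS :
    IsLocalization.Away (cobordantAlgebra.s u w) A[T;T⁻¹] :=
  cobordantAlgebra.isLocalization_away_s u w

/-- **The trivial cobordant blow-up `B₋ = B ∖ V(t⁻¹) = Spec A[t, t⁻¹] = Spec A × 𝔾_m ↪ B`**
(Włodarczyk, Def. 2.3.5): `Spec` of the inclusion `𝒪_B = A[t⁻¹, uᵢ t^{wᵢ}] ⊆ A[t, t⁻¹]`.
[cite: Wlodarczyk2022, Def. 2.3.5] -/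
def awayι : Spec (.of A[T;T⁻¹]) ⟶ cobordantBlowup u w :=
  Spec.map (CommRingCat.ofHom (algebraMap (cobordantAlgebra u w) A[T;T⁻¹]))

/-- `B₋ = Spec A[t, t⁻¹] → B` is an open immersion (`A[t, t⁻¹] = 𝒪_B[1/s]`,
`cobordantAlgebra.isLocalization_away_s`). [cite: Wlodarczyk2022, Def. 2.3.5] -/
instance isOpenImmersion_awayι : IsOpenImmersion (awayι u w) :=
  IsOpenImmersion.of_isLocalization (cobordantAlgebra.s u w)

/-- The image of `B₋ = Spec A[t, t⁻¹]` in `B` is `D(s) = B ∖ V(t⁻¹)` (Def. 2.3.5: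
`B₋ := B ∖ V(t⁻¹)`). [cite: Wlodarczyk2022, Def. 2.3.5] -/
theorem opensRange_awayι :
    (awayι u w).opensRange = PrimeSpectrum.basicOpen (cobordantAlgebra.s u w) := by
  rw [SetLike.ext'_iff]
  exact PrimeSpectrum.localization_away_comap_range (A[T;T⁻¹]) (cobordantAlgebra.s u w)

/-! ## The charts `D(uᵢ')` of `B₊` and Lemma 2.3.8 -/

/-- The chart `Spec 𝒪_B[1/uᵢ'] ⟶ B` of `B₊` (open immersion onto `D(uᵢ')`). [folklore] -/
def chartι (i : ι) :
    Spec (.of (Localization.Away (cobordantAlgebra.u' u w i))) ⟶ cobordantBlowup u w :=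
  Spec.map (CommRingCat.ofHom (algebraMap (cobordantAlgebra u w)
    (Localization.Away (cobordantAlgebra.u' u w i))))

/-- The chart maps are open immersions. [folklore] -/
instance isOpenImmersion_chartι (i : ι) : IsOpenImmersion (chartι u w i) := by
  unfold chartι
  infer_instance

/-- The image of the `i`-th chart is `D(uᵢ') ⊆ B₊`. [folklore] -/
theorem opensRange_chartι (i : ι) : (chartι u w i).opensRange = chart u w i := by
  unfold chartι chart
  exact Scheme.Hom.opensRange_localizationAway (R := CommRingCat.of (cobordantAlgebra u w))
    (cobordantAlgebra.u' u w i)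

/-- The charts lie in `B₊`. [folklore] -/
theorem chart_le_plus (i : ι) : chart u w i ≤ plus u w :=
  le_iSup (chart u w) i

/-- **Lemma 2.3.8 on the charts of `B₊` (integral form).** If `aᵢ wᵢ = m` for all `i`, the
inverse image of the ideal `(u₁^{a₁}, …, u_k^{a_k})` of `Spec A` (representing `𝒥^m`) along
`Spec 𝒪_B[1/uᵢ'] → B → Spec A` is the ideal sheaf of `s^m = t^{-m}`: Włodarczyk, "the cobordant
blow-up transforms the `ℚ`-ideal center `𝒥` into the ideal of the exceptional divisor
`D = V(t⁻¹)` on `B₊`: `𝒥 · 𝒪_{B₊} = t⁻¹ · 𝒪_{B₊}`". [cite: Wlodarczyk2022, Lemma 2.3.8] -/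
theorem comap_centrePow_chart {m : ℕ} {a : ι → ℕ} (ha : ∀ i, a i * w i = m) (i : ι) :
    (affineBlowup.idealSheaf (Ideal.span (Set.range fun j => u j ^ a j))).comap
        (chartι u w i ≫ π u w) =
      (affineBlowup.idealSheaf (Ideal.span {cobordantAlgebra.s u w ^ m})).comap (chartι u w i) := by
  rw [chartι, π, ← Spec.map_comp, ← CommRingCat.ofHom_comp, affineBlowup.idealSheaf,
    affineBlowup.idealSheaf, comap_ofIdealTop_SpecMap, comap_ofIdealTop_SpecMap]
  congr 2
  rw [cobordantAlgebra.map_span_pow_eq_span_s_pow u w _ ha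
    (IsLocalization.Away.algebraMap_isUnit (cobordantAlgebra.u' u w i)),
    Ideal.map_span, Set.image_singleton, map_pow]

/-- **Lemma 2.3.8 for weights `1`**: on each chart `D(uᵢ')` of `B₊` the inverse image of the
centre `𝒥 = (u₁, …, u_k)` is the exceptional ideal sheaf `(t⁻¹)`:
`𝒥 · 𝒪_{B₊} = t⁻¹ · 𝒪_{B₊}`. [cite: Wlodarczyk2022, Lemma 2.3.8] -/
theorem comap_centre_chart (hw : ∀ i, w i = 1) (i : ι) :
    (centre u).comap (chartι u w i ≫ π u w) = (exc u w).comap (chartι u w i) := by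
  have h := comap_centrePow_chart u w (m := 1) (a := fun _ => 1) (fun j => by rw [hw j]) i
  simp only [pow_one] at h
  exact h

/-! ## Strict transforms -/

/-- **The strict transform `σˢ(K)` on `B`** of an ideal sheaf `K` of `Spec A` under the full
cobordant blow-up (Włodarczyk, §3.3 "Strict transform of ideals": the schematic closure of
`(𝒪_B · K)|_{B₋}`, `B₋ = B ∖ V(t⁻¹)`, i.e. `σˢ(K) = {tᵃ f | f ∈ 𝒪_B · K, a ≥ 0}`): the
`(t⁻¹)`-saturation `⋃ₙ (π^*K : (s)ⁿ)` of the total transform, rendered with the colon ideal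
sheaves of `MarkedIdeals.lean` (cf. `strictTransformIdeal` there, where the saturation is by
the pulled-back centre; here by the exceptional ideal `(s)`, which differs from `π^*𝒥` along the
vertex). On global sections of the affine `B` this is `cobordantAlgebra.strictTransform`.
[cite: Wlodarczyk2022, §3.3] -/
def strictTransform (K : (Spec (.of A)).IdealSheafData) : (cobordantBlowup u w).IdealSheafData :=
  ⨆ n : ℕ, colon (K.comap (π u w)) (exc u w ^ n)

/-- **The strict transform on `B₊`** of an ideal sheaf `K` of `Spec A` under the cobordant
blow-up `σ₊ : B₊ → Spec A`: the restriction of `σˢ(K)` to the open `B₊` (Włodarczyk, Rem. after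
§3.3 "Strict transform of ideals": on `B₊` it "agrees with the classical definition", the
schematic closure of `(𝒪_B · K)|_{B₊ ∩ B₋}`). The strict transform of the closed subscheme
`X = V(K)` is `V(σˢ(K))`. [cite: Wlodarczyk2022, §3.3] -/
def strictTransformPlus (K : (Spec (.of A)).IdealSheafData) : (plus u w : Scheme.{u}).IdealSheafData :=
  (strictTransform u w K).comap (plus u w).ι

/-- The total transform is contained in the strict transform: `π^* K ≤ σˢ(K)`. [folklore] -/
theorem comap_le_strictTransform (K : (Spec (.of A)).IdealSheafData) :
    K.comap (π u w) ≤ strictTransform u w K := by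
  refine le_trans ?_ (le_iSup (fun n : ℕ => colon (K.comap (π u w)) (exc u w ^ n)) 0)
  rw [pow_zero, Scheme.IdealSheafData.one_eq_top, colon_top]

/-- Each saturation step `(π^*K : (s)ⁿ)` is contained in the strict transform. [folklore] -/
theorem colon_le_strictTransform (K : (Spec (.of A)).IdealSheafData) (n : ℕ) :
    colon (K.comap (π u w)) (exc u w ^ n) ≤ strictTransform u w K :=
  le_iSup (fun n : ℕ => colon (K.comap (π u w)) (exc u w ^ n)) n

/-- The strict transform of the unit ideal sheaf (empty subscheme) is the unit ideal sheaf.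
[folklore] -/
theorem strictTransform_top : strictTransform u w ⊤ = ⊤ :=
  top_le_iff.mp (le_trans (by rw [Scheme.IdealSheafData.comap_top]) (comap_le_strictTransform u w ⊤))

end cobordantBlowup

/-! ## The strict transform on global sections

On the affine scheme `B`, the strict transform `σˢ(Ĩ)` of the ideal sheaf `Ĩ` of an ideal
`I ⊆ A` is the ideal sheaf of the ring-level strict transform `cobordantAlgebra.strictTransform I`
(`cobordantBlowup.strictTransform_idealSheaf`), i.e. the scheme-level definition computes the
printed `{tᵃ f | f ∈ 𝒪_B · I}`. The transport lemmas go through Mathlib's order-ring isomorphism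
`Scheme.IdealSheafData.equivOfIsAffine : X.IdealSheafData ≃+*o Ideal Γ(X, ⊤)`. -/

section affineTransport

variable {X : Scheme.{u}} [IsAffine X]

/-- On an affine scheme, `ofIdealTop` is multiplicative. [folklore] -/
theorem ofIdealTop_mul (I J : Ideal Γ(X, ⊤)) :
    Scheme.IdealSheafData.ofIdealTop (I * J) =
      Scheme.IdealSheafData.ofIdealTop I * Scheme.IdealSheafData.ofIdealTop J :=
  map_mul (Scheme.IdealSheafData.equivOfIsAffine (X := X)).symm I J

/-- On an affine scheme, `ofIdealTop` commutes with powers. [folklore] -/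
theorem ofIdealTop_pow (I : Ideal Γ(X, ⊤)) (n : ℕ) :
    Scheme.IdealSheafData.ofIdealTop (I ^ n) = Scheme.IdealSheafData.ofIdealTop I ^ n :=
  map_pow (Scheme.IdealSheafData.equivOfIsAffine (X := X)).symm I n

/-- On an affine scheme, `ofIdealTop` commutes with suprema. [folklore] -/
theorem ofIdealTop_iSup {κ : Type*} (I : κ → Ideal Γ(X, ⊤)) :
    Scheme.IdealSheafData.ofIdealTop (⨆ k, I k) = ⨆ k, Scheme.IdealSheafData.ofIdealTop (I k) :=
  (Scheme.IdealSheafData.equivOfIsAffine (X := X)).symm.toOrderIso.map_iSup I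

/-- The colon ideal `(L : M)` is the largest ideal `J` with `M · J ⊆ L`. [folklore] -/
theorem sSup_setOf_mul_le_eq_colon {R : Type*} [CommRing R] (L M : Ideal R) :
    sSup {J : Ideal R | M * J ≤ L} = L.colon (M : Set R) := by
  apply le_antisymm
  · refine sSup_le fun J hJ j hj => Submodule.mem_colon.mpr fun m hm => ?_
    rw [smul_eq_mul, mul_comm]
    exact hJ (Ideal.mul_mem_mul hm hj)
  · refine le_sSup (show M * L.colon (M : Set R) ≤ L from Ideal.mul_le.mpr fun m hm c hc => ?_)
    rw [mul_comm]
    exact Submodule.mem_colon.mp hc m hm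

/-- On an affine scheme, the colon ideal sheaf (`colon`, `MarkedIdeals.lean`) of two ideal
sheaves given by ideals of global sections is the ideal sheaf of their colon ideal. [folklore] -/
theorem colon_ofIdealTop (L M : Ideal Γ(X, ⊤)) :
    colon (Scheme.IdealSheafData.ofIdealTop L) (Scheme.IdealSheafData.ofIdealTop M) =
      Scheme.IdealSheafData.ofIdealTop (L.colon (M : Set Γ(X, ⊤))) := by
  let E := (Scheme.IdealSheafData.equivOfIsAffine (X := X)).symm
  change colon (E L) (E M) = E (L.colon (M : Set Γ(X, ⊤)))
  have h1 : E (sSup {J : Ideal Γ(X, ⊤) | M * J ≤ L}) = sSup (E '' {J | M * J ≤ L}) := by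
    rw [sSup_image]
    exact E.toOrderIso.map_sSup _
  rw [← sSup_setOf_mul_le_eq_colon, h1, colon]
  congr 1
  ext K
  constructor
  · intro hK
    refine ⟨E.symm K, ?_, E.apply_symm_apply K⟩
    change M * E.symm K ≤ L
    have h : E (M * E.symm K) ≤ E L := by
      rw [map_mul, E.apply_symm_apply]
      exact hK
    exact (map_le_map_iff E).mp h
  · rintro ⟨J, hJ, rfl⟩
    change E M * E J ≤ E L
    rw [← map_mul]
    exact (map_le_map_iff E).mpr hJ

/-- Colon ideals are transported by ring isomorphisms (given as a pair of inverse ring maps).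
[folklore] -/
theorem colon_map_of_inverse {R S : Type*} [CommRing R] [CommRing S] (f : R →+* S) (g : S →+* R)
    (hgf : ∀ x, g (f x) = x) (hfg : ∀ y, f (g y) = y) (J : Ideal R) (M : Set R) :
    (J.map f).colon (f '' M) = (J.colon M).map f := by
  have hf : Function.Surjective f := fun y => ⟨g y, hfg y⟩
  have hmem : ∀ (K : Ideal R) (y : S), y ∈ K.map f ↔ g y ∈ K := by
    intro K y
    rw [Ideal.mem_map_iff_of_surjective f hf]
    constructor
    · rintro ⟨x, hx, rfl⟩
      rwa [hgf]
    · intro h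
      exact ⟨g y, h, hfg y⟩
  ext y
  rw [hmem, Submodule.mem_colon, Submodule.mem_colon]
  constructor
  · intro h m hm
    have h' := h (f m) ⟨m, hm, rfl⟩
    rw [smul_eq_mul, hmem, map_mul, hgf] at h'
    rwa [smul_eq_mul]
  · rintro h _ ⟨m, hm, rfl⟩
    rw [smul_eq_mul, hmem, map_mul, hgf]
    exact h m hm

end affineTransport

namespace cobordantBlowup

/-- The total transform of `Ĩ` is the ideal sheaf of `I · 𝒪_B`. [folklore] -/
theorem comap_π_idealSheaf (I : Ideal A) :
    (affineBlowup.idealSheaf I).comap (π u w) =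
      affineBlowup.idealSheaf (I.map (algebraMap A (cobordantAlgebra u w))) := by
  unfold π
  exact comap_ofIdealTop_SpecMap _ _

/-- **The strict transform on global sections is the printed one**: for an ideal `I ⊆ A`, the
ideal sheaf `σˢ(Ĩ) = ⋃ₙ (π^*Ĩ : (s)ⁿ)` on the affine scheme `B` is the ideal sheaf of the
`s`-saturation `⋃ₙ (I·𝒪_B : sⁿ) = {tᵃ f | f ∈ 𝒪_B · I}` (`cobordantAlgebra.strictTransform`,
Włodarczyk §3.3). [cite: Wlodarczyk2022, §3.3] -/
theorem strictTransform_idealSheaf (I : Ideal A) :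
    strictTransform u w (affineBlowup.idealSheaf I) =
      affineBlowup.idealSheaf (cobordantAlgebra.strictTransform u w I) := by
  set ε : cobordantAlgebra u w →+* Γ(cobordantBlowup u w, ⊤) :=
    (Scheme.ΓSpecIso (.of (cobordantAlgebra u w))).inv.hom with hε
  set η : Γ(cobordantBlowup u w, ⊤) →+* cobordantAlgebra u w :=
    (Scheme.ΓSpecIso (.of (cobordantAlgebra u w))).hom.hom with hη
  have hηε : ∀ x, η (ε x) = x := fun x => by
    rw [hε, hη, ← CommRingCat.comp_apply, Iso.inv_hom_id]; rfl
  have hεη : ∀ y, ε (η y) = y := fun y => by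
    rw [hε, hη, ← CommRingCat.comp_apply, Iso.hom_inv_id]; rfl
  have hexc : ∀ n : ℕ, exc u w ^ n =
      Scheme.IdealSheafData.ofIdealTop ((Ideal.span {cobordantAlgebra.s u w ^ n}).map ε) := by
    intro n
    rw [← Ideal.span_singleton_pow, Ideal.map_pow, ofIdealTop_pow]
    rfl
  unfold strictTransform
  rw [comap_π_idealSheaf]
  have hcolon : ∀ n : ℕ, colon (affineBlowup.idealSheaf (I.map (algebraMap A (cobordantAlgebra u w))))
      (exc u w ^ n) = Scheme.IdealSheafData.ofIdealTop
        ((((I.map (algebraMap A (cobordantAlgebra u w))).colon {cobordantAlgebra.s u w ^ n})).map ε) := by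
    intro n
    rw [hexc n, affineBlowup.idealSheaf, colon_ofIdealTop, Ideal.map_span, Set.image_singleton,
      Ideal.colon_span, ← Set.image_singleton, colon_map_of_inverse ε η hηε hεη]
  simp_rw [hcolon]
  rw [← ofIdealTop_iSup, ← Ideal.map_iSup]
  rfl

end cobordantBlowup

end Literature.AlgebraicGeometry.Resolution
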